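import Summits.QuantumFields.BalabanUV.Beta.GAN24.S3ShapeL0Contraction
import Summits.QuantumFields.BalabanUV.Beta.GAN24.TaylorSandwich
import Summits.QuantumFields.BalabanUV.Beta.GAN24.TaylorLamVertexPairing
import Summits.QuantumFields.BalabanUV.Beta.GAN24.StencilSlotE3PhiLeg
import Summits.QuantumFields.BalabanUV.Beta.GAN24.StencilSlotE3HLeg

/-!
# `BalabanUV.Beta.GAN24.S3ShapeL0` — binder row G-an2-4 / (CONV-C), S-slot, road «S3-Taylor», SHAPE row **S3-L0** (the level-`0` Λ piece of
# `S₀` read by every member), part 2: THE ROW AT `d = 3` — from the two outer legs and one scalar bracket bound (`rowL0_of_bracket`), and from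
# the two outer legs ALONE via leaf-18's vertex identity and the K-slot Φ̃-leg (`rowL0_of_legs`, θ = Lc⁻¹) (holder of ROW-Λ0:
# b2b-balaban-gan24-formalise-leaf-08, gen 11; INTENT CLAIMS l.4822; typer `GAN24/Formal/LEAVES.md` PART III row S3-L0; part 1 = `GAN24/S3ShapeL0Contraction`)

NOT IN PRINT; OUR PROOF ATTEMPT.  HONEST FRAMING (cell contract, verbatim): «discharging `BetaPertH` makes Bałaban's UV stability
UNCONDITIONAL — a real constructive-QFT result; it is NOT the continuum limit and NOT the Clay problem.»  HONEST DEPENDENCY (verbatim):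
«continuum YM on T⁴ ⇐ BetaPertH ∧ nine spine estimates (0/9 proved); BetaPertH ⇐ (D1) ∧ (D4) ∧ CAP+tail; G-an2-4 gates asym, D1 and
NE2/3/4.»  [folklore] assembly BY NAME of TREE modules: `E3UnitSplitLevels.e3Lam0_unit_split` (leaf-01, the template), `TaylorSandwich.sandwich_bound`
(gan24-p1), `S3ShapeL0Contraction` (part 1), `TaylorLamVertexPairing.abs_vertexPair_le` (leaf-18, the vertex identity), `StencilSlotE3PhiLeg.phiLeg_three`
(gan24-p1, the K-slot multiplier–multiplier leg, unconditional at `d = 3`), `StencilSlotE3HLeg.legs_three` (gan24-p1 over leaf-16's (N1)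
`FineReadoutDecay.exists_wH_decay`: the two outer legs, unconditional at `d = 3`); 0 `def`, 0 cite, 0 `Prop` mirror, 0 sorry.  The conclusion is ONE hypothesis
of `StencilSlotE3OfPieces.e3Shape_of_pieces` (its binder `hL0` verbatim — TREE module p206983, staged 2cc3c5eb8d83de1a — at `d = 3`, fully specialised) — §3∕§4 CONDITIONAL on the
displayed (N1)-legs, §5 unconditional; it discharges NOTHING of (hS, hSall) by itself; «E3Shape»∕«E3SupRate» remain OPEN; NOT BetaPertH, NOT continuum, NOT Clay.

## The row and its count (member `p = n+2`, `N = Lc^p`; the level-0 table `SLam Lc (lamCoeffOf (KInv Lc) Lc) hessFF` sits at FIXED blocking `Lc`)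
By the template, `N^{2(d+1)}·e3OfS N (((Lc^{d+1})^{n+1}·cΛ) • SLam …) = −(cΛ∕Lc^{d+1})·N^{d−2}·[one-channel unit sandwich]`, the sandwich reading
the table against the legs `G̃_N = N^{d+2}·GamΦ_N` (left), `H̃_N = N^{d+2}·wH_N` (right) and the block-averaged vertex leg `N^{−(d+1)}Σ'_u H̃_N(κ″κ′; u − N•u′)`.
The vertex leg meets the table ONLY through THE BRACKET `β(μ,yy) := Σ_{κ″} Σ'_u wH_N κ″ κ′ (u − N•u′)·lamCoeffOf (KInv Lc) Lc μ yy κ″ u`; by absolute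
values the row costs `N^{d−2}·[(N∕Lc)^{d+1} bonds per N-block]·N^{−(d+1)}·sup|N^{d+2}β|`, so the typed `c₀L·θ^{n+1}` IS a bound
`|N^{d+2}·β| ≤ Cβ·r^p·e^{−κ|quo_N(Lc•yy) − u′|₁}` with `θ = Lc^{d−2}·r` (§3).  leaf-18-g12's identity (CLAIMS l.4813∕l.4877): the bracket is `−𝒬ᵀ_R` of
the TOP multiplier–multiplier leg `wΦ_N`, `R = N∕Lc`, so `|β| ≤ R·CΦ_N·e^{δ}e^{−δ|quo_R yy − u′|₁}` with `CΦ_N = CΦ·N^{−2(d+1)}` from the K-slot leg —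
`r = Lc^{1−d} = Lc⁻²`, **θ = Lc⁻¹** at `d = 3` (§4); ENGINE-B's measured Λ per-push ratio ≈ Lc (CLAIMS l.4662 (d), l.4719).

## What is proved (`d = 3`, every `Lc ≥ 1`; `θ < 1` iff `Lc ≥ 2` is the consumer's side condition)
§3 **`rowL0_of_bracket`**: outer legs (in `StencilSlotE3HLeg.legs_three`'s literal currency) + bracket bound `(Cβ, r)` ⇒
   `∃ c₀L, ∀ n, LocStencil (row S3-L0's function at member n+2) (c₀L·(Lc·r)^{n+1}) (κ∕2)`, `c₀L = (|cΛ|∕Lc⁴)·4C²CβMass·E²Zl₄(κ∕2)·(Lc·r)` displayed.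
§4 `wPhi_bound_of_phiLeg`, `bracket_bound`, **`rowL0_of_legs`**: outer legs ALONE ⇒ `∃ c₀L δL, 0 < δL ∧ ∀ n, LocStencil (…) (c₀L·(Lc⁻¹)^{n+1}) δL` —
   i.e. `∃ c₀L δL, 0 < δL ∧ S3.ShapeL0 3 Lc cΛ c₀L Lc⁻¹ δL` (`δL = min(κ, δ_Φ)∕2`, `δ_Φ` the K-slot rate of `phiLeg_three`).
§5 **`rowL0_holds`**: the row UNCONDITIONALLY at `d = 3` (every `Lc ≥ 1`, every `cΛ`, `θ = Lc⁻¹` displayed), the legs from `StencilSlotE3HLeg.legs_three`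
   (leaf-16's (N1)); **`rowL0_shape`** (`Lc ≥ 2`): the END's binder shape `∃ c₀L θ δ, 0 ≤ c₀L ∧ 0 ≤ θ ∧ θ < 1 ∧ 0 < δ ∧ hL0`.
-/

noncomputable section

open Finset
open scoped BigOperators
open Literature.MathematicalPhysics.QuantumFieldTheory
open Literature.MathematicalPhysics.QuantumFieldTheory.Balaban1983to89
open Literature.MathematicalPhysics.QuantumFieldTheory.Balaban1983to89.Beta
open Literature.Probability.LatticeModels (Torus.proj)
open B12Sec2to5 (l1 l1_nonneg)
open ExpKernelCalculus (MKer Zl BiLoc Decays)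
open LatticeForm (quo)
open KernelSpecInstance (wH)
open KKTFluctuationKernel (GamΦ)
open OneStepResolventKernel (Fib LocStencil KInv)
open AveragingHessianKernels (hessFF hessKer Near ell)
open InterLevelTransport (SLam cwsum cwsum_apply onLat onLat_zsmul onLat_off)
open BalabanStepJets (lamCoeffOf)
open Summit.QuantumFields.BalabanUV.Beta.GAN24.E3UnitSplit (e3OfS e3Lam0_unit_split e3OfS_inl_inr e3OfS_inr)
open Summit.QuantumFields.BalabanUV.Beta.GAN24.TaylorSandwich (sandwich_bound)

open Summit.QuantumFields.BalabanUV.Beta.GAN24.S3ShapeL0Contraction (inner_eq_onLat support_onLat_hessFF mass_onLat_hessFF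
  l1_le_of_mem_colBox leg_onLat)
open Summit.QuantumFields.BalabanUV.Beta.GAN24.TaylorLamVertexPairing (abs_vertexPair_le quo_quo)
open Summit.QuantumFields.BalabanUV.Beta.GAN24.StencilSlotE3PhiLeg (phiLeg_three)
open Summit.QuantumFields.BalabanUV.Beta.GAN24.StencilSlotE3HLeg (legs_three)

namespace Summit.QuantumFields.BalabanUV.Beta.GAN24.S3ShapeL0

/-! ## §3 The row at `d = 3` -/

section Row

variable {Lc : ℕ} [NeZero Lc]

/-- **ROW S3-L0 FROM THE TWO OUTER LEGS AND THE BRACKET BOUND** [folklore] (`d = 3`; conclusion = the hypothesis `hL0` of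
`StencilSlotE3OfPieces.e3Shape_of_pieces` VERBATIM — `∃ c₀L, S3.ShapeL0 3 Lc cΛ c₀L (Lc·r) (κ∕2)` — binder `hL0` of the TREE module `StencilSlotE3OfPieces` (p206983; staged 2cc3c5eb8d83de1a) verbatim at `d = 3`).
INPUTS (hypotheses, discharged BY NAME elsewhere): `hH`∕`hG` = the vertex∕right and left legs in `StencilSlotE3HLeg.legs_three`'s literal shape
((N1), leaf-16's `FineReadoutDecay.exists_wH_decay`, re-currencied by the row owner); `hβ` = THE BRACKET BOUND
`|N^{3+2}·Σ_{κ″}Σ'_v wH_N κ″ κ′ (v − N•u′)·lamCoeffOf (KInv Lc) Lc μ yy κ″ v| ≤ Cβ·r^{j+1}·e^{−κ|quo_N(Lc•yy) − u′|₁}`, `N = Lc^{j+1}`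
(leaf-18's `TaylorLamVertexPairing.abs_vertexPair_le` + `StencilSlotE3PhiLeg.phiLeg_three` give it with `r = Lc⁻²`, hence `θ = Lc·r = Lc⁻¹`).
PROOF: `e3Lam0_unit_split` → `inner_eq_onLat` under the sandwich → `TaylorSandwich.sandwich_bound` with the synthetic pair (CH = Cβ·r^p, the §2 mass)
→ `|−(cΛ∕Lc⁴)·N^{3−2}|·bound = c₀L·(Lc·r)^{n+1}·e^{−(κ∕2)(|x′−u′|₁+|z′−u′|₁)}`; the off-diagonal∕multiplier blocks of `e3OfS` vanish (`e3OfS_inl_inr`, `e3OfS_inr`).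
Nothing of (hS, hSall) is discharged; NOT BetaPertH, NOT continuum, NOT Clay. -/
theorem rowL0_of_bracket (hLc : 1 ≤ Lc) (cΛ : ℝ) {C κ Cβ r : ℝ} (hκ : 0 < κ) (hC : 0 ≤ C) (hCβ : 0 ≤ Cβ) (hr : 0 ≤ r)
    (hH : ∀ (j : ℕ) (k l : Fin (3 + 1)) (u u' : Fin (3 + 1) → ℤ),
      |((Lc : ℝ) ^ (j + 1)) ^ (3 + 2) * wH (N := Lc ^ (j + 1)) k l (u - (((Lc ^ (j + 1) : ℕ) : ℤ)) • u')| ≤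
        C * Real.exp (-κ * l1 (quo (Lc ^ (j + 1)) u - u')))
    (hG : ∀ (j : ℕ) (α l : Fin (3 + 1)) (x' w : Fin (3 + 1) → ℤ),
      |((Lc : ℝ) ^ (j + 1)) ^ (3 + 2) * GamΦ (N := Lc ^ (j + 1)) α x' l w| ≤
        C * Real.exp (-κ * l1 (x' - quo (Lc ^ (j + 1)) w)))
    (hβ : ∀ (j : ℕ) (κ' μ : Fin (3 + 1)) (u' yy : Fin (3 + 1) → ℤ),
      |((Lc : ℝ) ^ (j + 1)) ^ (3 + 2) * ∑ κ'' : Fin (3 + 1), ∑' v : Fin (3 + 1) → ℤ,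
          wH (N := Lc ^ (j + 1)) κ'' κ' (v - (((Lc ^ (j + 1) : ℕ) : ℤ)) • u') *
            lamCoeffOf (KInv (N := Lc) (d := 3)) Lc μ yy κ'' v| ≤
        Cβ * r ^ (j + 1) * Real.exp (-κ * l1 (quo (Lc ^ (j + 1)) ((Lc : ℤ) • yy) - u'))) :
    ∃ c₀L : ℝ, 0 ≤ c₀L ∧ ∀ n : ℕ, LocStencil (fun κ' u' x' z' a b => ((Lc : ℝ) ^ (n + 1 + 1)) ^ (2 * (3 + 1)) *
      e3OfS (Lc ^ (n + 1 + 1)) (fun κ u => (((Lc : ℝ) ^ (3 + 1)) ^ (n + 1) * cΛ) •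
        SLam Lc (lamCoeffOf (KInv (N := Lc) (d := 3)) Lc) (fun μ y => hessFF Lc μ y) κ u) κ' u' x' z' a b)
      (c₀L * ((Lc : ℝ) * r) ^ (n + 1)) (κ / 2) := by
  -- the `n`-free constants
  set Mass : ℝ := (((2 * (2 * Lc) + 1) ^ (3 + 1) : ℕ) : ℝ) * ((3 + 1) * ((3 + 1) *
    ((((2 * (2 * Lc) + 1) ^ (3 + 1) : ℕ) : ℝ) * (2 * (ell (3 + 1) Lc : ℝ) ^ 2)))) with hMass
  set R : ℝ := ((3 : ℝ) + 1) * ((2 * Lc : ℕ) : ℝ) with hR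
  set E : ℝ := Real.exp (κ * (R + (3 + 1))) with hE
  set K : ℝ := (3 + 1) * (C * C * Cβ * Mass * (E * E)) * Zl (3 + 1) (κ / 2) with hK
  have hL0 : (0 : ℝ) < Lc := by exact_mod_cast Nat.pos_of_ne_zero (NeZero.ne Lc)
  have hR0 : 0 ≤ R := by rw [hR]; positivity
  have hMass0 : 0 ≤ Mass := by rw [hMass]; positivity
  have hZ : 0 ≤ Zl (3 + 1) (κ / 2) := ExpKernelCalculus.Zl_nonneg (by positivity)
  have hK0 : 0 ≤ K := by rw [hK]; positivity
  refine ⟨|cΛ| / (Lc : ℝ) ^ (3 + 1) * K * ((Lc : ℝ) * r), by positivity, fun n => ?_⟩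
  intro κ' u' x' z' a b
  dsimp only
  have hrhs0 : 0 ≤ |cΛ| / (Lc : ℝ) ^ (3 + 1) * K * ((Lc : ℝ) * r) * ((Lc : ℝ) * r) ^ (n + 1) *
      Real.exp (-(κ / 2) * (l1 (x' - u') + l1 (z' - u'))) := by positivity
  rcases a with α | μ₀
  · rcases b with β | ν₀
    · -- the field–field block: template, vertex contraction, sandwich
      rw [e3Lam0_unit_split (Lc := Lc) (d := 3) cΛ (n + 1) (n + 1 + 1) rfl κ' u' x' z' α β]
      simp_rw [inner_eq_onLat]
      set p : ℕ := n + 1 + 1 with hp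
      have hN1 : (1 : ℝ) ≤ ((Lc ^ p : ℕ) : ℝ) := by exact_mod_cast Nat.one_le_pow _ _ (Nat.pos_of_ne_zero (NeZero.ne Lc))
      -- the sandwich bound with the synthetic vertex pair
      have hS := sandwich_bound (N := Lc ^ p) (d := 3) (κ := κ) (CA := C) (CB := C) (CH := Cβ * r ^ p) (Mass := Mass)
        (RW := R) (RU := R) (x' := x') (u' := u') (z' := z')
        (A := fun l w => ((Lc : ℝ) ^ p) ^ (3 + 2) * GamΦ (N := Lc ^ p) α x' l w)
        (B := fun l' y => ((Lc : ℝ) ^ p) ^ (3 + 2) * wH (N := Lc ^ p) l' β (y - (((Lc ^ p : ℕ) : ℤ)) • z'))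
        (H := fun μ u => onLat Lc (fun yy => ((Lc : ℝ) ^ p) ^ (3 + 2) * ∑ κ'' : Fin (3 + 1), ∑' v : Fin (3 + 1) → ℤ,
          wH (N := Lc ^ p) κ'' κ' (v - (((Lc ^ p : ℕ) : ℤ)) • u') * lamCoeffOf (KInv (N := Lc) (d := 3)) Lc μ yy κ'' v) u)
        (T := fun μ u w l y l' => onLat Lc (fun yy => -hessFF Lc μ yy) u w y (Sum.inl l) (Sum.inl l'))
        (Sw := fun y => Fintype.piFinset (fun i => Finset.Icc (y i - ((2 * Lc : ℕ) : ℤ)) (y i + ((2 * Lc : ℕ) : ℤ))))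
        (Su := fun y => Fintype.piFinset (fun i => Finset.Icc (y i - ((2 * Lc : ℕ) : ℤ)) (y i + ((2 * Lc : ℕ) : ℤ))))
        hκ (fun l w => hG (n + 1) α l x' w) (fun l' y => hH (n + 1) l' β y z')
        (fun μ u => leg_onLat (N := Lc ^ p) (by positivity) (fun μ yy => hβ (n + 1) κ' μ u' yy) μ u)
        (fun μ u w l y l' h => (support_onLat_hessFF h).1) (fun μ u w l y l' h => (support_onLat_hessFF h).2)
        (fun y w hw => l1_le_of_mem_colBox hw) (fun y u hu => l1_le_of_mem_colBox hu)
        (fun y l' => mass_onLat_hessFF hLc y l')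
      -- the level-dependent transfer factors are at most `E`
      have hEN : Real.exp (κ * (R / ((Lc ^ p : ℕ) : ℝ) + (3 + 1))) ≤ E := by
        rw [hE, Real.exp_le_exp]
        have : R / ((Lc ^ p : ℕ) : ℝ) ≤ R := div_le_self hR0 hN1
        nlinarith
      have hE0 : 0 ≤ Real.exp (κ * (R / ((Lc ^ p : ℕ) : ℝ) + (3 + 1))) := (Real.exp_pos _).le
      have hbnd : (3 + 1) * (C * C * (Cβ * r ^ p) * Mass *
          (Real.exp (κ * (R / ((Lc ^ p : ℕ) : ℝ) + (3 + 1))) * Real.exp (κ * (R / ((Lc ^ p : ℕ) : ℝ) + (3 + 1))))) *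
          Zl (3 + 1) (κ / 2) ≤ K * r ^ p := by
        rw [hK]
        have h2 : Real.exp (κ * (R / ((Lc ^ p : ℕ) : ℝ) + (3 + 1))) * Real.exp (κ * (R / ((Lc ^ p : ℕ) : ℝ) + (3 + 1))) ≤
            E * E := mul_le_mul hEN hEN hE0 ((Real.exp_pos _).le)
        have h3 : 0 ≤ (3 + 1 : ℝ) * (C * C * (Cβ * r ^ p) * Mass) * Zl (3 + 1) (κ / 2) := by positivity
        nlinarith
      have hz : ((Lc : ℝ) ^ p) ^ (((3 : ℕ) : ℤ) - 2) = (Lc : ℝ) ^ p := by norm_num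
      rw [hz]
      simp only [Nat.cast_pow, Nat.cast_ofNat] at hS hbnd ⊢
      have hpref : |-(cΛ / (Lc : ℝ) ^ (3 + 1)) * (Lc : ℝ) ^ p| = |cΛ| / (Lc : ℝ) ^ (3 + 1) * (Lc : ℝ) ^ p := by
        rw [abs_mul, abs_neg, abs_div, abs_of_pos (pow_pos hL0 _), abs_of_pos (pow_pos hL0 _)]
      rw [abs_mul, hpref]
      have hfin : |cΛ| / (Lc : ℝ) ^ (3 + 1) * (Lc : ℝ) ^ p * (K * r ^ p * Real.exp (-(κ / 2) * (l1 (x' - u') + l1 (z' - u')))) =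
          |cΛ| / (Lc : ℝ) ^ (3 + 1) * K * ((Lc : ℝ) * r) * ((Lc : ℝ) * r) ^ (n + 1) *
            Real.exp (-(κ / 2) * (l1 (x' - u') + l1 (z' - u'))) := by
        rw [hp]; ring
      rw [← hfin]
      refine mul_le_mul_of_nonneg_left (hS.trans ?_) (by positivity)
      exact mul_le_mul_of_nonneg_right hbnd (Real.exp_pos _).le
    · rw [e3OfS_inl_inr, mul_zero, abs_zero]
      exact hrhs0
  · rw [e3OfS_inr, mul_zero, abs_zero]
    exact hrhs0

/-! ## §4 The bracket bound from the vertex identity and the K-slot leg; the row from the outer legs alone -/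

/-- [folklore] THE TOP MULTIPLIER–MULTIPLIER LEG in the currency of `TaylorLamVertexPairing.abs_vertexPair_le`, from the first conjunct of
`StencilSlotE3PhiLeg.phiLeg_three` (read at the coarse points `N•y`, `N•0`; `KInv_inr_inr_coarse`). -/
theorem wPhi_bound_of_phiLeg {CΦ δ : ℝ}
    (hΦ : ∀ (j : ℕ) (x' w : Fin (3 + 1) → ℤ) (α β : Fin (3 + 1)),
      |((Lc : ℝ) ^ (j + 1)) ^ (2 * (3 + 1)) *
          KInv (N := Lc ^ (j + 1)) (d := 3) (((Lc ^ (j + 1) : ℕ) : ℤ) • x') w (Sum.inr α) (Sum.inr β)| ≤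
        CΦ * Real.exp (-δ * l1 (x' - quo (Lc ^ (j + 1)) w)))
    (j : ℕ) (κ' k : Fin (3 + 1)) (y : Fin (3 + 1) → ℤ) :
    |KernelSpecInstance.wΦ (N := Lc ^ (j + 1)) k κ' y| ≤
      CΦ * (((Lc : ℝ) ^ (j + 1)) ^ (2 * (3 + 1)))⁻¹ * Real.exp (-δ * l1 y) := by
  have hN : (0 : ℝ) < ((Lc : ℝ) ^ (j + 1)) ^ (2 * (3 + 1)) :=
    pow_pos (pow_pos (by exact_mod_cast Nat.pos_of_ne_zero (NeZero.ne Lc)) _) _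
  have h := hΦ j y ((((Lc ^ (j + 1) : ℕ) : ℤ)) • (0 : Fin (3 + 1) → ℤ)) k κ'
  rw [OneStepResolventKernel.KInv_inr_inr_coarse, OneStepResolventKernel.quo_zsmul, sub_zero, abs_mul, abs_of_pos hN] at h
  calc |KernelSpecInstance.wΦ (N := Lc ^ (j + 1)) k κ' y|
      = (((Lc : ℝ) ^ (j + 1)) ^ (2 * (3 + 1)))⁻¹ *
          (((Lc : ℝ) ^ (j + 1)) ^ (2 * (3 + 1)) * |KernelSpecInstance.wΦ (N := Lc ^ (j + 1)) k κ' y|) := by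
        rw [← mul_assoc, inv_mul_cancel₀ hN.ne', one_mul]
    _ ≤ (((Lc : ℝ) ^ (j + 1)) ^ (2 * (3 + 1)))⁻¹ * (CΦ * Real.exp (-δ * l1 y)) :=
        mul_le_mul_of_nonneg_left h (inv_nonneg.mpr hN.le)
    _ = _ := by ring

/-- [folklore] **THE BRACKET BOUND OF ROW S3-L0** (`d = 3`): from the top multiplier–multiplier leg `|wΦ_N k κ′ y| ≤ CΦ·N^{−8}·e^{−δ|y|₁}`,
leaf-18's `abs_vertexPair_le` at inner level `Lc`, depth `R = Lc^j`, gives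
`|N^{3+2}·β_j(κ′,u′;μ,yy)| ≤ (CΦ·e^{δ}·Lc⁻¹)·(Lc⁻²)^{j+1}·e^{−δ|quo_N(Lc•yy) − u′|₁}` — the hypothesis `hβ` of `rowL0_of_bracket` with `r = Lc⁻²`. -/
theorem bracket_bound {CΦ δ : ℝ} (hδ : 0 ≤ δ)
    (hΦ : ∀ (j : ℕ) (κ' k : Fin (3 + 1)) (y : Fin (3 + 1) → ℤ), |KernelSpecInstance.wΦ (N := Lc ^ (j + 1)) k κ' y| ≤
      CΦ * (((Lc : ℝ) ^ (j + 1)) ^ (2 * (3 + 1)))⁻¹ * Real.exp (-δ * l1 y))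
    (j : ℕ) (κ' μ : Fin (3 + 1)) (u' yy : Fin (3 + 1) → ℤ) :
    |((Lc : ℝ) ^ (j + 1)) ^ (3 + 2) * ∑ κ'' : Fin (3 + 1), ∑' v : Fin (3 + 1) → ℤ,
        wH (N := Lc ^ (j + 1)) κ'' κ' (v - (((Lc ^ (j + 1) : ℕ) : ℤ)) • u') *
          lamCoeffOf (KInv (N := Lc) (d := 3)) Lc μ yy κ'' v| ≤
      CΦ * Real.exp δ * (Lc : ℝ)⁻¹ * (((Lc : ℝ)⁻¹) ^ 2) ^ (j + 1) *
        Real.exp (-δ * l1 (quo (Lc ^ (j + 1)) ((Lc : ℤ) • yy) - u')) := by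
  have hL : (0 : ℝ) < Lc := by exact_mod_cast Nat.pos_of_ne_zero (NeZero.ne Lc)
  have hN5 : (0 : ℝ) ≤ ((Lc : ℝ) ^ (j + 1)) ^ (3 + 2) := by positivity
  have hvp := abs_vertexPair_le (N := Lc ^ (j + 1)) (N' := Lc) (R := Lc ^ j) (d := 3) (pow_succ' Lc j) κ' μ u' yy hδ
    (fun k y => hΦ j κ' k y)
  -- `quo (Lc^j) yy = quo (Lc^(j+1)) (Lc•yy)`
  have hq : quo (Lc ^ j) yy = quo (Lc ^ (j + 1)) ((Lc : ℤ) • yy) := by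
    have h1 := quo_quo (D := 3 + 1) Lc (Lc ^ j) ((Lc : ℤ) • yy)
    rw [OneStepResolventKernel.quo_zsmul, ← pow_succ'] at h1
    exact h1
  rw [hq] at hvp
  rw [abs_mul, abs_of_nonneg hN5]
  refine (mul_le_mul_of_nonneg_left hvp hN5).trans (le_of_eq ?_)
  have hL0 : (Lc : ℝ) ≠ 0 := hL.ne'
  simp only [inv_pow, ← pow_mul, Nat.cast_pow]
  field_simp
  ring

/-- **ROW S3-L0 FROM THE TWO OUTER LEGS ALONE, θ = Lc⁻¹** [folklore] (`d = 3`): the (N1)-legs in `StencilSlotE3HLeg.legs_three`'s literal currency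
imply `∃ c₀L δL, 0 < δL ∧ ∀ n, LocStencil (row S3-L0's function at member n+2) (c₀L·(Lc⁻¹)^{n+1}) δL` — i.e. `∃ c₀L δL, 0 < δL ∧ S3.ShapeL0 3 Lc cΛ c₀L Lc⁻¹ δL`
(binder `hL0` of the TREE module `StencilSlotE3OfPieces` (p206983; staged 2cc3c5eb8d83de1a) verbatim at `d = 3`); `δL = min(κ, δ_Φ)∕2` with `δ_Φ` the K-slot rate of `StencilSlotE3PhiLeg.phiLeg_three` (unconditional at
`d = 3`), the bracket bound by `bracket_bound` (leaf-18's `TaylorLamVertexPairing.abs_vertexPair_le`).  One hypothesis of `e3Shape_of_pieces`; discharges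
NOTHING of (hS, hSall) by itself; NOT BetaPertH, NOT continuum, NOT Clay. -/
theorem rowL0_of_legs (hLc : 1 ≤ Lc) (cΛ : ℝ) {C κ : ℝ} (hκ : 0 < κ) (hC : 0 ≤ C)
    (hH : ∀ (j : ℕ) (k l : Fin (3 + 1)) (u u' : Fin (3 + 1) → ℤ),
      |((Lc : ℝ) ^ (j + 1)) ^ (3 + 2) * wH (N := Lc ^ (j + 1)) k l (u - (((Lc ^ (j + 1) : ℕ) : ℤ)) • u')| ≤
        C * Real.exp (-κ * l1 (quo (Lc ^ (j + 1)) u - u')))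
    (hG : ∀ (j : ℕ) (α l : Fin (3 + 1)) (x' w : Fin (3 + 1) → ℤ),
      |((Lc : ℝ) ^ (j + 1)) ^ (3 + 2) * GamΦ (N := Lc ^ (j + 1)) α x' l w| ≤
        C * Real.exp (-κ * l1 (x' - quo (Lc ^ (j + 1)) w))) :
    ∃ c₀L δL : ℝ, 0 ≤ c₀L ∧ 0 < δL ∧ ∀ n : ℕ, LocStencil (fun κ' u' x' z' a b => ((Lc : ℝ) ^ (n + 1 + 1)) ^ (2 * (3 + 1)) *
      e3OfS (Lc ^ (n + 1 + 1)) (fun κ u => (((Lc : ℝ) ^ (3 + 1)) ^ (n + 1) * cΛ) •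
        SLam Lc (lamCoeffOf (KInv (N := Lc) (d := 3)) Lc) (fun μ y => hessFF Lc μ y) κ u) κ' u' x' z' a b)
      (c₀L * ((Lc : ℝ)⁻¹) ^ (n + 1)) δL := by
  obtain ⟨CΦ, δ, hδ, hCΦ, hΦ1, -⟩ := phiLeg_three (Lc := Lc)
  set κ₀ : ℝ := min κ δ with hκ₀
  have hκ₀pos : 0 < κ₀ := lt_min hκ hδ
  have hκ₀κ : κ₀ ≤ κ := min_le_left _ _
  have hκ₀δ : κ₀ ≤ δ := min_le_right _ _
  have hL : (0 : ℝ) < Lc := by exact_mod_cast Nat.pos_of_ne_zero (NeZero.ne Lc)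
  -- legs and bracket at the common rate κ₀
  have hH' : ∀ (j : ℕ) (k l : Fin (3 + 1)) (u u' : Fin (3 + 1) → ℤ),
      |((Lc : ℝ) ^ (j + 1)) ^ (3 + 2) * wH (N := Lc ^ (j + 1)) k l (u - (((Lc ^ (j + 1) : ℕ) : ℤ)) • u')| ≤
        C * Real.exp (-κ₀ * l1 (quo (Lc ^ (j + 1)) u - u')) := fun j k l u u' =>
    OneStepResolventKernel.bound_mono (hH j k l u u') hC le_rfl hκ₀κ (l1_nonneg _)
  have hG' : ∀ (j : ℕ) (α l : Fin (3 + 1)) (x' w : Fin (3 + 1) → ℤ),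
      |((Lc : ℝ) ^ (j + 1)) ^ (3 + 2) * GamΦ (N := Lc ^ (j + 1)) α x' l w| ≤
        C * Real.exp (-κ₀ * l1 (x' - quo (Lc ^ (j + 1)) w)) := fun j α l x' w =>
    OneStepResolventKernel.bound_mono (hG j α l x' w) hC le_rfl hκ₀κ (l1_nonneg _)
  have hCβ : 0 ≤ CΦ * Real.exp δ * (Lc : ℝ)⁻¹ := by positivity
  have hβ' : ∀ (j : ℕ) (κ' μ : Fin (3 + 1)) (u' yy : Fin (3 + 1) → ℤ),
      |((Lc : ℝ) ^ (j + 1)) ^ (3 + 2) * ∑ κ'' : Fin (3 + 1), ∑' v : Fin (3 + 1) → ℤ,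
          wH (N := Lc ^ (j + 1)) κ'' κ' (v - (((Lc ^ (j + 1) : ℕ) : ℤ)) • u') *
            lamCoeffOf (KInv (N := Lc) (d := 3)) Lc μ yy κ'' v| ≤
        CΦ * Real.exp δ * (Lc : ℝ)⁻¹ * (((Lc : ℝ)⁻¹) ^ 2) ^ (j + 1) *
          Real.exp (-κ₀ * l1 (quo (Lc ^ (j + 1)) ((Lc : ℤ) • yy) - u')) := fun j κ' μ u' yy =>
    OneStepResolventKernel.bound_mono (bracket_bound hδ.le (wPhi_bound_of_phiLeg hΦ1) j κ' μ u' yy)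
      (by positivity) le_rfl hκ₀δ (l1_nonneg _)
  obtain ⟨c₀L, hc₀, h⟩ := rowL0_of_bracket hLc cΛ hκ₀pos hC hCβ (by positivity) hH' hG' hβ'
  refine ⟨c₀L, κ₀ / 2, hc₀, by positivity, fun n => ?_⟩
  have e : (Lc : ℝ) * ((Lc : ℝ)⁻¹) ^ 2 = (Lc : ℝ)⁻¹ := by field_simp
  rw [← e]
  exact h n

/-! ## §5 The row, unconditionally at `d = 3` -/

/-- **ROW S3-L0 HOLDS AT `d = 3`, θ = Lc⁻¹** [folklore]: for every `Lc ≥ 1` and every weight `cΛ`,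
`∃ c₀L δL, 0 < δL ∧ ∀ n, LocStencil (row S3-L0's function at member n+2) (c₀L·(Lc⁻¹)^{n+1}) δL` — the hypothesis `hL0` of
`StencilSlotE3OfPieces.e3Shape_of_pieces` (binder `hL0` of the TREE module `StencilSlotE3OfPieces` (p206983; staged 2cc3c5eb8d83de1a) verbatim at `d = 3`) with `θ = Lc⁻¹` (`< 1` iff `Lc ≥ 2`): the (N1)-legs
from `StencilSlotE3HLeg.legs_three` (leaf-16's `FineReadoutDecay.exists_wH_decay`, re-currencied by the row owner) fed to `rowL0_of_legs`.
ONE of the twelve analytic rows of the S-slot table; it discharges NOTHING of (hS, hSall) by itself; «E3Shape»∕«E3SupRate» need all twelve;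
NOT BetaPertH, NOT continuum, NOT Clay. -/
theorem rowL0_holds (hLc : 1 ≤ Lc) (cΛ : ℝ) :
    ∃ c₀L δL : ℝ, 0 ≤ c₀L ∧ 0 < δL ∧ ∀ n : ℕ, LocStencil (fun κ' u' x' z' a b => ((Lc : ℝ) ^ (n + 1 + 1)) ^ (2 * (3 + 1)) *
      e3OfS (Lc ^ (n + 1 + 1)) (fun κ u => (((Lc : ℝ) ^ (3 + 1)) ^ (n + 1) * cΛ) •
        SLam Lc (lamCoeffOf (KInv (N := Lc) (d := 3)) Lc) (fun μ y => hessFF Lc μ y) κ u) κ' u' x' z' a b)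
      (c₀L * ((Lc : ℝ)⁻¹) ^ (n + 1)) δL := by
  obtain ⟨C, κ, hκ, hC, hH, hG⟩ := legs_three (Lc := Lc)
  exact rowL0_of_legs hLc cΛ hκ hC hH hG

/-- **ROW S3-L0 IN THE END'S BINDER SHAPE** [folklore] (`d = 3`, `Lc ≥ 2`): `∃ c₀L θ δ, 0 ≤ c₀L ∧ 0 ≤ θ ∧ θ < 1 ∧ 0 < δ ∧ hL0` — literally
`∃ c₀L θ δ, … ∧ S3.ShapeL0 3 Lc cΛ c₀L θ δ` with the END's side conditions on `(θ, δ)` (ref2 r35 (l): the row carries its own `θ_row = Lc⁻¹ < 1`,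
`δ_row > 0`); the assembler weakens `(c₀L, θ, δ)` to the table's common values by `LocStencil` monotonicity.  Discharges NOTHING of (hS, hSall)
by itself; NOT BetaPertH, NOT continuum, NOT Clay. -/
theorem rowL0_shape (hLc : 2 ≤ Lc) (cΛ : ℝ) :
    ∃ c₀L θ δ : ℝ, 0 ≤ c₀L ∧ 0 ≤ θ ∧ θ < 1 ∧ 0 < δ ∧ ∀ n : ℕ,
      LocStencil (fun κ' u' x' z' a b => ((Lc : ℝ) ^ (n + 1 + 1)) ^ (2 * (3 + 1)) *
        e3OfS (Lc ^ (n + 1 + 1)) (fun κ u => (((Lc : ℝ) ^ (3 + 1)) ^ (n + 1) * cΛ) •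
          SLam Lc (lamCoeffOf (KInv (N := Lc) (d := 3)) Lc) (fun μ y => hessFF Lc μ y) κ u) κ' u' x' z' a b)
        (c₀L * θ ^ (n + 1)) δ := by
  obtain ⟨c₀L, δL, hc₀, hδL, h⟩ := rowL0_holds (Lc := Lc) (le_trans (by norm_num) hLc) cΛ
  have hL : (2 : ℝ) ≤ Lc := by exact_mod_cast hLc
  refine ⟨c₀L, (Lc : ℝ)⁻¹, δL, hc₀, by positivity, ?_, hδL, h⟩
  rw [inv_lt_one_iff₀]
  exact Or.inr (by linarith)

end Row

end Summit.QuantumFields.BalabanUV.Beta.GAN24.S3ShapeL0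

end
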